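import Summits.HodgeConjecture.HodgeConjecture.Theorems.Ring2AbelianAllSpreadFrame
import HarnessLib

/-!
# Ring 2 · sub-cell AbelianAll · spread-1, part V — THE EFFECTIVE FACE AND THE GERM FACE OF ROW U ARE ROW U
# (request M1 in the kernel: bounded complexity of the representing cycles along a Zariski-dense anchor set ⟺ every
# fibre algebraic ⟺ ONE stratum is the whole base ⟺ algebraic on a germ at one CM fibre)

HONEST FRAMING (page 1, verbatim): **research route, not a corollary; conditional on HC_CM plus one named minimal
statement.** Cell line: research route conditional on HC_CM; not a corollary; Q11.4-sentence-2 already refuted in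
dim ≥ 3. Nothing below proves a case of the Hodge conjecture; no statement minted in this cell is cited as a fact; the
Hilbert-scheme decomposition of the algebraicity locus enters through the tree's PROVED rendering
`charlesSchnell_algebraicityLocus_iUnion_closed_holds`. Seat `pub-hodge-ring2-ab-spread-1` (gen 2); companion of part IV
`Ring2AbelianAllSpreadExistential` (U_∃); parts I–III: `Ring2AbelianAllSpread`, `Ring2AbelianAllSpreadDomination`,
`Ring2AbelianAllSpreadFrame`; row U = deform's `UniformAlgebraicityAtCMPoints` / per family `UniformAlgebraicityOn`.

## §B The effective face of row U is row U (request `ab-spread-1/M1`, answered by atlas-2; kernel form here)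

Request M1 (SPREAD.md §5) asked the atlas / engine seats for the DEGREE of the known algebraic representatives of a
flat Hodge section at CM anchors — "bounded along a Hecke orbit, or growing with the discriminant?" — as a test of
the effective strengthening U_eff of row U ("finitely many relative-Hilbert strata cover the CM locus", deform II-a
`exists_closed_stratum_of_finite_strata`). atlas-2 answered STRUCTURALLY (`REQUESTS.jsonl` `ab-spread-1/M1#atlas-2`,
`data/atlas/spread/M1-atlas2-ANSWER.md` §1): for a global class on an irreducible family the three statements
(a) complexity bounded on SOME Zariski-dense set of fibres, (b) the class algebraic at EVERY fibre, (c) complexity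
bounded UNIFORMLY on the base, are EQUIVALENT (relative Chow/Hilbert schemes proper over `S`, cycle classes locally
constant, Baire) — so M1's dichotomy IS the Hodge conjecture for the section on the family, no numerics bears on it,
and U_eff is not an independent premise. §B is that theorem on the tree's carriers, for ANY countable decomposition
`Z : ℕ → Set S` of the algebraicity locus of a global class `A ∈ H²ᵖ(𝒳(ℂ); ℂ)` into complex-point sets of
Zariski-closed subsets (the Charles–Schnell decomposition by relative Hilbert schemes, PROVED in the tree as
`charlesSchnell_algebraicityLocus_iUnion_closed_holds`, is one such; "complexity ≤ δ₀" = "in the first δ₀ strata"):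

* (c) ⟹ (b) ⟹ (c): every fibre algebraic ⟺ SOME stratum `Z k` is all of `S` (`forall_mem_algebraicClasses_iff_exists_stratum_eq_univ`;
  ⟸ trivial, ⟹ Baire + irreducibility, `exists_stratum_eq_univ_of_isOpen_subset_iUnion` proved HERE from the
  Literature-level API `ComplexPoints.baireSpace` / `ComplexPoints.interior_setOf_pt_mem_eq_empty`);
* (a) ⟹ (b): FINITELY many strata covering a set of fibres ZARISKI-dense on points force every fibre algebraic
  (`forall_mem_algebraicClasses_of_finite_strata_of_zariskiDense`: a finite union of strata is one closed stratum of
  algebraic fibres, part I `forall_mem_algebraicClasses_of_zariskiDense_of_subset_closed`); (b) ⟹ (a) with one stratum;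
* on a row-U family (CM locus dense): "finitely many strata cover the CM locus" ⟺ "every fibre algebraic" ⟺ "one
  stratum is `S`" (`finite_strata_cover_cmLocus_iff_forall`), i.e. U_eff(f, W) ⟺ U's conclusion on (f, W): the
  effective face adds nothing and cannot be sampled at anchors short of deciding row U on the family; where row U's
  conclusion is KNOWN the bound exists INEFFECTIVELY (no `δ₀` in print anywhere, atlas-2 §3).

Consequence recorded in SPREAD.md §8: M1 is WITHDRAWN as a mechanism test (answered-structural); the spread axis keeps
exactly the nodes S_ZD ⟹ U_Z ⟹ U ⟹[hF] U_∃ ⟹ `CMToAbelian`, with `HC_CM` load-bearing from U down.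

REV. 2 (seat gen 11, 2026-08-20; REFEREE-AB F-ab-28 SERVED): rev. 1 consumed BY NAME two theorems of the crux-line
namespace `Cruxes.HodgeAbelianVarieties.SubtorusGalleryBlochSeeds.Stubs` and `Theorems.univ_not_subset_iUnion_setOf_pt_mem`
(build-fragility for a publication module). Rev. 2 consumes NO such declaration: the Baire step is re-proved here
(`exists_stratum_eq_univ_of_isOpen_subset_iUnion`) from the LITERATURE-level API only (`ComplexPoints.baireSpace`,
`ComplexPoints.interior_setOf_pt_mem_eq_empty`, `isClosed_setOf_pt_mem`; separatedness of `S` inline), and "algebraic on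
a non-empty Euclidean-open set of fibres ⟹ algebraic at every fibre" is the new fact-free
`forall_mem_algebraicClasses_of_isOpen`. Every rev.-1 STATEMENT is byte-identical. Honest residue: the stub file stays in
the TRANSITIVE import closure through deform's `Ring2DeformSpreading` (a sorry-free `Theorems/` module; count once).

References (bib keys): CharlesSchnell2014Notes (Prop. 11.3.11, Cor. 11.3.6, Thm. 11.5.11); VoisinHodgeII2003 (§3.3.1,
§7.3.2); Voisin2007HodgeLoci (§0); BuchweitzFlenner2003 (Thm. 5.2); Deligne1982HodgeCycles (Prop. 6.1); SGA1 (Exp. XII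
Prop. 2.2, Cor. 2.3, Prop. 3.1); ConradAdelicPoints2012 (Prop. 3.1).
-/

set_option linter.dupNamespace false

noncomputable section

namespace Summit.HodgeConjecture.HodgeConjecture.Ring2.AbelianAll

open CategoryTheory AlgebraicGeometry
open Literature.AlgebraicGeometry Literature.AlgebraicGeometry.Motives
open Literature.AlgebraicGeometry.HodgeTheory
open Summit.HodgeConjecture.HodgeConjecture
open Literature.AlgebraicGeometry.Deligne1982 (deligne1982_cmDenseMumfordTateFamilies)
open Summit.HodgeConjecture.HodgeConjecture.Theses.RankFourFaces (CMToAbelian)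
open Summit.HodgeConjecture.HodgeConjecture.Ring2.Deform (cmLocus UniformAlgebraicityAtCMPoints exists_closed_stratum_of_finite_strata
  forall_mem_algebraicClasses_of_dense_of_subset_closed)
open Summit.HodgeConjecture.HodgeConjecture.Ring2.Hypotheses (UniformAlgebraicityOn
  uniformAlgebraicityAtCMPoints_iff_forall_uniformAlgebraicityOn)

variable {𝒳 S : SchemeOver ℂ}

/-! ## §B The effective face of row U is row U (atlas-2's answer to M1, on the tree's carriers)

Throughout, `Z : ℕ → Set S` is ANY countable family of Zariski-closed subsets whose complex points decompose the
algebraicity locus of the global class `A` (hypothesis `hL`); the Charles–Schnell decomposition by relative Hilbert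
schemes (`charlesSchnell_algebraicityLocus_iUnion_closed_holds`) is the instance in which "the first `δ₀` strata" means
"representing cycles of complexity `≤ δ₀`". -/

/-- (c) ⟹ (b): if ONE stratum of the decomposition is the whole base, the class is algebraic at every fibre. [folklore] -/
theorem forall_mem_algebraicClasses_of_stratum_eq_univ (f : 𝒳 ⟶ S) {p : ℕ} {A : complexBetti 𝒳 (2 * p)}
    {Z : ℕ → Set S.left}
    (hL : {t : ComplexPoints S | complexBetti.map (fiberι f t) (2 * p) A ∈ algebraicClasses (fiberOver f t) p} =
      ⋃ k, {t : ComplexPoints S | t.pt ∈ Z k})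
    {k : ℕ} (hk : Z k = Set.univ) (t : ComplexPoints S) :
    complexBetti.map (fiberι f t) (2 * p) A ∈ algebraicClasses (fiberOver f t) p := by
  have ht : t ∈ ⋃ k, {t : ComplexPoints S | t.pt ∈ Z k} :=
    Set.mem_iUnion.2 ⟨k, by simp only [Set.mem_setOf_eq, hk, Set.mem_univ]⟩
  rw [← hL] at ht
  exact ht

/-- **Baire spreading on the base, from the Literature-level API only** (rev. 2, F-ab-28). For `S` quasi-projective
irreducible over `ℂ` and countably many Zariski-closed `Z k ⊆ S`, a non-empty Euclidean-open `U ⊆ S(ℂ)` covered by the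
`Z k(ℂ)` forces some `Z k = S`: otherwise every `Z k(ℂ)` is closed with empty interior (SGA1 XII 2.2/2.3), their union is
meagre, and so would be `U` — impossible, `S(ℂ)` is Baire (Hausdorff, SGA1 XII 3.1; locally compact, Conrad 3.1).
[cite: VoisinHodgeII2003, §7.3.2, proof of Thm. 7.19] [cite: SGA1, Exp. XII Prop. 2.2, Cor. 2.3 and Prop. 3.1]
[cite: ConradAdelicPoints2012, Prop. 3.1] -/
theorem exists_stratum_eq_univ_of_isOpen_subset_iUnion (hS : IsQuasiProjectiveOver S) [IrreducibleSpace S.left]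
    {Z : ℕ → Set S.left} (hZc : ∀ k, IsClosed (Z k)) {U : Set (ComplexPoints S)} (hU : IsOpen U) (hUne : U.Nonempty)
    (hUZ : U ⊆ ⋃ k, {t : ComplexPoints S | t.pt ∈ Z k}) : ∃ k, Z k = Set.univ := by
  haveI : LocallyOfFiniteType S.hom := locallyOfFiniteType_of_isQuasiProjectiveOver hS
  haveI : IsSeparated S.hom := by
    -- `S` is open in a projective, hence proper (so separated), `ℂ`-scheme
    obtain ⟨P, j, hP, hj⟩ := hS
    haveI : IsProper P.hom := hP.isProper
    rw [show S.hom = j.left ≫ P.hom from (Over.w j).symm]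
    infer_instance
  haveI : BaireSpace (ComplexPoints S) := ComplexPoints.baireSpace S
  by_contra hne
  have hne' : ∀ k, Z k ≠ Set.univ := fun k hk ↦ hne ⟨k, hk⟩
  have hmeagre : ∀ k, IsMeagre {t : ComplexPoints S | t.pt ∈ Z k} := fun k ↦
    (((isClosed_setOf_pt_mem (hZc k)).isNowhereDense_iff).2
      (ComplexPoints.interior_setOf_pt_mem_eq_empty (hZc k) (hne' k))).isMeagre
  exact not_isMeagre_of_isOpen hU hUne ((isMeagre_iUnion hmeagre).mono hUZ)

/-- **(b) ⟹ (c) (Baire + irreducibility): if the class is algebraic at EVERY fibre, then for every countable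
decomposition of its algebraicity locus into complex-point sets of Zariski-closed subsets of the irreducible
quasi-projective base, ONE stratum is the whole base** — "uniformly bounded complexity", ineffectively
(`exists_stratum_eq_univ_of_isOpen_subset_iUnion` with `U = S(ℂ)`: complex points of an irreducible quasi-projective
`ℂ`-scheme are not covered by countably many proper closed subsets). [cite: VoisinHodgeII2003, §7.3.2, proof of Thm. 7.19]
[cite: CharlesSchnell2014Notes, Prop. 11.3.11 (proof)] -/
theorem exists_stratum_eq_univ_of_forall_mem_algebraicClasses (f : 𝒳 ⟶ S) {p : ℕ} (hS : IsQuasiProjectiveOver S)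
    [IrreducibleSpace S.left] [Nonempty (ComplexPoints S)] {A : complexBetti 𝒳 (2 * p)} {Z : ℕ → Set S.left}
    (hZc : ∀ k, IsClosed (Z k))
    (hL : {t : ComplexPoints S | complexBetti.map (fiberι f t) (2 * p) A ∈ algebraicClasses (fiberOver f t) p} =
      ⋃ k, {t : ComplexPoints S | t.pt ∈ Z k})
    (hall : ∀ t : ComplexPoints S, complexBetti.map (fiberι f t) (2 * p) A ∈ algebraicClasses (fiberOver f t) p) :
    ∃ k, Z k = Set.univ := by
  refine exists_stratum_eq_univ_of_isOpen_subset_iUnion hS hZc isOpen_univ Set.univ_nonempty fun t _ ↦ ?_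
  rw [← hL]
  exact hall t

/-- **(b) ⟺ (c)**: every fibre algebraic iff one stratum is the whole base. [cite: CharlesSchnell2014Notes, Prop. 11.3.11 (proof)]
[cite: VoisinHodgeII2003, §3.3.1 and §7.3.2] -/
theorem forall_mem_algebraicClasses_iff_exists_stratum_eq_univ (f : 𝒳 ⟶ S) {p : ℕ} (hS : IsQuasiProjectiveOver S)
    [IrreducibleSpace S.left] [Nonempty (ComplexPoints S)] {A : complexBetti 𝒳 (2 * p)} {Z : ℕ → Set S.left}
    (hZc : ∀ k, IsClosed (Z k))
    (hL : {t : ComplexPoints S | complexBetti.map (fiberι f t) (2 * p) A ∈ algebraicClasses (fiberOver f t) p} =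
      ⋃ k, {t : ComplexPoints S | t.pt ∈ Z k}) :
    (∀ t : ComplexPoints S, complexBetti.map (fiberι f t) (2 * p) A ∈ algebraicClasses (fiberOver f t) p) ↔
      ∃ k, Z k = Set.univ :=
  ⟨exists_stratum_eq_univ_of_forall_mem_algebraicClasses f hS hZc hL,
    fun ⟨_, hk⟩ ↦ forall_mem_algebraicClasses_of_stratum_eq_univ f hL hk⟩

/-- **(a) ⟹ (b): FINITELY many strata covering a set of fibres that is ZARISKI-dense on points force the class to be
algebraic at every fibre** — a finite union of strata is ONE closed stratum of algebraic fibres (deform II-a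
`exists_closed_stratum_of_finite_strata`) and part I's Zariski-form spreading lemma applies. No density in the analytic
topology, no hypothesis on `f`. [cite: VoisinHodgeII2003, §3.3.1] [cite: CharlesSchnell2014Notes, Prop. 11.3.11 (proof)] -/
theorem forall_mem_algebraicClasses_of_finite_strata_of_zariskiDense (f : 𝒳 ⟶ S) {p : ℕ} {A : complexBetti 𝒳 (2 * p)}
    {Z : ℕ → Set S.left} (hZc : ∀ k, IsClosed (Z k))
    (hL : {t : ComplexPoints S | complexBetti.map (fiberι f t) (2 * p) A ∈ algebraicClasses (fiberOver f t) p} =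
      ⋃ k, {t : ComplexPoints S | t.pt ∈ Z k})
    {Λ : Set (ComplexPoints S)} (hΛ : zariskiClosureOnPoints Λ = Set.univ) (F : Finset ℕ)
    (hcover : ∀ s ∈ Λ, ∃ k ∈ F, s.pt ∈ Z k) (t : ComplexPoints S) :
    complexBetti.map (fiberι f t) (2 * p) A ∈ algebraicClasses (fiberOver f t) p := by
  have halg : ∀ (k : F) (t : ComplexPoints S), t.pt ∈ Z k →
      complexBetti.map (fiberι f t) (2 * p) A ∈ algebraicClasses (fiberOver f t) p := by
    intro k t ht
    have ht' : t ∈ ⋃ k, {t : ComplexPoints S | t.pt ∈ Z k} := Set.mem_iUnion.2 ⟨k, ht⟩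
    rw [← hL] at ht'
    exact ht'
  obtain ⟨W, hWc, hWalg, hΛW⟩ := exists_closed_stratum_of_finite_strata f (fun k : F ↦ Z k) (fun k ↦ hZc k) halg
    (Λ := Λ) fun s hs ↦ by
      obtain ⟨k, hk, hsk⟩ := hcover s hs
      exact ⟨⟨k, hk⟩, hsk⟩
  exact forall_mem_algebraicClasses_of_zariskiDense_of_subset_closed f hΛ hWc hWalg hΛW t

/-- **(a) ⟺ (b) ⟺ (c) along a Zariski-dense set of fibres** (atlas-2's M1 theorem, kernel form): on an irreducible
quasi-projective base, "finitely many strata cover the Zariski-dense `Λ`" ⟺ "every fibre algebraic" ⟺ "one stratum is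
the base". [cite: CharlesSchnell2014Notes, Prop. 11.3.11 (proof)] [cite: VoisinHodgeII2003, §3.3.1 and §7.3.2] -/
theorem finite_strata_cover_iff_forall_of_zariskiDense (f : 𝒳 ⟶ S) {p : ℕ} (hS : IsQuasiProjectiveOver S)
    [IrreducibleSpace S.left] [Nonempty (ComplexPoints S)] {A : complexBetti 𝒳 (2 * p)} {Z : ℕ → Set S.left}
    (hZc : ∀ k, IsClosed (Z k))
    (hL : {t : ComplexPoints S | complexBetti.map (fiberι f t) (2 * p) A ∈ algebraicClasses (fiberOver f t) p} =
      ⋃ k, {t : ComplexPoints S | t.pt ∈ Z k})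
    {Λ : Set (ComplexPoints S)} (hΛ : zariskiClosureOnPoints Λ = Set.univ) :
    ((∃ F : Finset ℕ, ∀ s ∈ Λ, ∃ k ∈ F, s.pt ∈ Z k) ↔
        ∀ t : ComplexPoints S, complexBetti.map (fiberι f t) (2 * p) A ∈ algebraicClasses (fiberOver f t) p) ∧
      ((∃ F : Finset ℕ, ∀ s ∈ Λ, ∃ k ∈ F, s.pt ∈ Z k) ↔ ∃ k, Z k = Set.univ) := by
  have hab : (∃ F : Finset ℕ, ∀ s ∈ Λ, ∃ k ∈ F, s.pt ∈ Z k) ↔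
      ∀ t : ComplexPoints S, complexBetti.map (fiberι f t) (2 * p) A ∈ algebraicClasses (fiberOver f t) p := by
    refine ⟨fun ⟨F, hF⟩ ↦ forall_mem_algebraicClasses_of_finite_strata_of_zariskiDense f hZc hL hΛ F hF, fun hall ↦ ?_⟩
    obtain ⟨k, hk⟩ := exists_stratum_eq_univ_of_forall_mem_algebraicClasses f hS hZc hL hall
    exact ⟨{k}, fun s _ ↦ ⟨k, Finset.mem_singleton_self k, by simp only [hk, Set.mem_univ]⟩⟩
  exact ⟨hab, hab.trans (forall_mem_algebraicClasses_iff_exists_stratum_eq_univ f hS hZc hL)⟩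

/-- **On a row-U family: bounded complexity along the (dense) CM locus ⟺ every fibre algebraic ⟺ one stratum is
the base** — M1's dichotomy "bounded along the CM anchors vs. unbounded" IS row U's conclusion for `(f, W)`; the
effective strengthening U_eff of row U adds nothing, and cannot be sampled at anchors short of deciding row U on the
family (atlas-2, `ab-spread-1/M1#atlas-2` §1; analytic density ⟹ Zariski density on points, part I
`zariskiClosureOnPoints_eq_univ_of_dense`). [cite: CharlesSchnell2014Notes, Prop. 11.3.11 and Thm. 11.5.11]
[cite: VoisinHodgeII2003, §7.3.2] -/
theorem finite_strata_cover_cmLocus_iff_forall (f : 𝒳 ⟶ S) {n p : ℕ} (hS : IsQuasiProjectiveOver S)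
    [IrreducibleSpace S.left] [Nonempty (ComplexPoints S)] (hD : Dense (cmLocus f n)) {W : complexBetti 𝒳 (2 * p)}
    {Z : ℕ → Set S.left} (hZc : ∀ k, IsClosed (Z k))
    (hL : {t : ComplexPoints S | complexBetti.map (fiberι f t) (2 * p) W ∈ algebraicClasses (fiberOver f t) p} =
      ⋃ k, {t : ComplexPoints S | t.pt ∈ Z k}) :
    ((∃ F : Finset ℕ, ∀ s ∈ cmLocus f n, ∃ k ∈ F, s.pt ∈ Z k) ↔
        ∀ t : ComplexPoints S, complexBetti.map (fiberι f t) (2 * p) W ∈ algebraicClasses (fiberOver f t) p) ∧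
      ((∃ F : Finset ℕ, ∀ s ∈ cmLocus f n, ∃ k ∈ F, s.pt ∈ Z k) ↔ ∃ k, Z k = Set.univ) :=
  finite_strata_cover_iff_forall_of_zariskiDense f hS hZc hL (zariskiClosureOnPoints_eq_univ_of_dense hD)

/-- **The Charles–Schnell instance on a row-U family**: for a smooth projective family over a smooth irreducible
quasi-projective base with quasi-projective total space and a fibrewise class `W`, THERE IS a decomposition as in §B
(relative Hilbert schemes, PROVED in the tree), and for it: every fibre algebraic ⟺ one stratum is the base ⟺ (CM
locus dense) finitely many strata cover the CM locus. [cite: CharlesSchnell2014Notes, Prop. 11.3.11]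
[cite: VoisinHodgeII2003, §3.3.1 and §7.3.2] [cite: Voisin2007HodgeLoci, §0] -/
theorem exists_charlesSchnell_strata_tfae (f : 𝒳 ⟶ S) {n p : ℕ} (h𝒳 : IsQuasiProjectiveOver 𝒳)
    (hS : IsQuasiProjectiveOver S) (hSsm : AlgebraicGeometry.Smooth S.hom) [IrreducibleSpace S.left]
    [Nonempty (ComplexPoints S)] (hf : IsSmoothProjectiveFamily f n) (hD : Dense (cmLocus f n))
    (W : complexBetti 𝒳 (2 * p)) :
    ∃ Z : ℕ → Set S.left, (∀ k, IsClosed (Z k)) ∧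
      {t : ComplexPoints S | complexBetti.map (fiberι f t) (2 * p) W ∈ algebraicClasses (fiberOver f t) p} =
        ⋃ k, {t : ComplexPoints S | t.pt ∈ Z k} ∧
      ((∀ t : ComplexPoints S, complexBetti.map (fiberι f t) (2 * p) W ∈ algebraicClasses (fiberOver f t) p) ↔
        ∃ k, Z k = Set.univ) ∧
      ((∃ F : Finset ℕ, ∀ s ∈ cmLocus f n, ∃ k ∈ F, s.pt ∈ Z k) ↔
        ∀ t : ComplexPoints S, complexBetti.map (fiberι f t) (2 * p) W ∈ algebraicClasses (fiberOver f t) p) := by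
  obtain ⟨Z, hZc, hL⟩ := charlesSchnell_algebraicityLocus_iUnion_closed_holds f n p h𝒳 hS hSsm hf W
  exact ⟨Z, hZc, hL, forall_mem_algebraicClasses_iff_exists_stratum_eq_univ f hS hZc hL,
    (finite_strata_cover_cmLocus_iff_forall f hS hD hZc hL).1⟩

/-- **Row U per family = its effective face** ("U_eff(f) ⟺ U(f)"): on a row-U family (smooth projective over a
smooth irreducible quasi-projective base, quasi-projective total space, dense CM locus), deform's row U on `f`
(`UniformAlgebraicityOn f n`: ONE closed stratum of algebraic fibres contains the CM locus) holds iff for every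
admissible `W` algebraic at all CM fibres and EVERY decomposition of its algebraicity locus, FINITELY many strata cover
the CM locus. (⟹: density, then (b) ⟹ (c) by Baire; ⟸: applied to the Charles–Schnell decomposition, a finite union
of strata is the closed stratum row U asks for, deform II-a `exists_closed_stratum_of_finite_strata`.) So the
effective strengthening is not a separate node of the axis. [cite: CharlesSchnell2014Notes, Prop. 11.3.11]
[cite: VoisinHodgeII2003, §3.3.1 and §7.3.2] -/
theorem uniformAlgebraicityOn_iff_finite_strata_cover_cmLocus (f : 𝒳 ⟶ S) {n : ℕ} (h𝒳 : IsQuasiProjectiveOver 𝒳)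
    (hS : IsQuasiProjectiveOver S) (hSsm : AlgebraicGeometry.Smooth S.hom) [IrreducibleSpace S.left]
    [Nonempty (ComplexPoints S)] (hf : IsSmoothProjectiveFamily f n) (hD : Dense (cmLocus f n)) :
    UniformAlgebraicityOn f n ↔
      ∀ (p : ℕ) (W : complexBetti 𝒳 (2 * p)),
        (∀ s : ComplexPoints S, IsRationalClass (complexBetti.map (fiberι f s) (2 * p) W) ∧
          IsOfHodgeType n (fiberOver f s) (2 * p) p p (complexBetti.map (fiberι f s) (2 * p) W)) →
        (∀ s ∈ cmLocus f n, complexBetti.map (fiberι f s) (2 * p) W ∈ algebraicClasses (fiberOver f s) p) →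
        ∀ Z : ℕ → Set S.left, (∀ k, IsClosed (Z k)) →
          {t : ComplexPoints S | complexBetti.map (fiberι f t) (2 * p) W ∈ algebraicClasses (fiberOver f t) p} =
            ⋃ k, {t : ComplexPoints S | t.pt ∈ Z k} →
          ∃ F : Finset ℕ, ∀ s ∈ cmLocus f n, ∃ k ∈ F, s.pt ∈ Z k := by
  constructor
  · intro hU p W hW hcm Z hZc hL
    obtain ⟨W₀, hW₀c, hW₀alg, hcmW₀⟩ := hU p W hW hcm
    exact (finite_strata_cover_cmLocus_iff_forall f hS hD hZc hL).1.2
      (forall_mem_algebraicClasses_of_dense_of_subset_closed f hD hW₀c hW₀alg hcmW₀)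
  · intro h p W hW hcm
    obtain ⟨Z, hZc, hL⟩ := charlesSchnell_algebraicityLocus_iUnion_closed_holds f n p h𝒳 hS hSsm hf W
    obtain ⟨F, hF⟩ := h p W hW hcm Z hZc hL
    have halg : ∀ (k : F) (t : ComplexPoints S), t.pt ∈ Z k →
        complexBetti.map (fiberι f t) (2 * p) W ∈ algebraicClasses (fiberOver f t) p := by
      intro k t ht
      have ht' : t ∈ ⋃ k, {t : ComplexPoints S | t.pt ∈ Z k} := Set.mem_iUnion.2 ⟨k, ht⟩
      rw [← hL] at ht'
      exact ht'
    exact exists_closed_stratum_of_finite_strata f (fun k : F ↦ Z k) (fun k ↦ hZc k) halg fun s hs ↦ by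
      obtain ⟨k, hk, hsk⟩ := hF s hs
      exact ⟨⟨k, hk⟩, hsk⟩

/-! ## §B′ The GERM face of row U is row U (the output shape of Bloch's semiregularity theorem)

The one GENERIZATION engine in print — Bloch's semiregularity theorem (tree fact
`HodgeTheory.BlochSemiregularSpread`, Bloch 1972 / Buchweitz–Flenner 2003 Thm. 5.2 / Voisin L7 Thm. 2.4; realized on
Weil-type families by Markman 2025 and by the b2b cell's `WeilTypeLadderCMBlochSeed`) — outputs exactly "algebraic on an
OPEN NEIGHBOURHOOD of the anchor `s₀`". On an irreducible base that is already everything (Baire: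
`exists_stratum_eq_univ_of_isOpen_subset_iUnion` / `forall_mem_algebraicClasses_of_isOpen`, both proved in THIS file from
the Literature-level API since rev. 2), so row U on a family is equivalent to its GERM form at ONE CM fibre. Recorded for the implication map: a CM
Bloch seed for `(f, W)` discharges row U on `(f, W)` WITHOUT using `HC_CM` beyond the anchor (the seed carries its own
cycle) — the Bloch twin is a CM-anchored but `HC_CM`-free line, owned by the crux lines on stmt-1333 / stmt-2524, not a
complement of `HC_CM`; no AbelianAll seed statement is typed here. -/

/-- **Germ ⟹ everywhere, for any decomposition**: on an irreducible quasi-projective base, if the class is algebraic on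
a non-empty Euclidean-open set of fibres then ONE stratum is the base and the class is algebraic at every fibre.
[cite: VoisinHodgeII2003, §7.3.2, proof of Thm. 7.19] [cite: CharlesSchnell2014Notes, Prop. 11.3.11 (proof)] -/
theorem forall_mem_algebraicClasses_of_isOpen_of_strata (f : 𝒳 ⟶ S) {p : ℕ} (hS : IsQuasiProjectiveOver S)
    [IrreducibleSpace S.left] {A : complexBetti 𝒳 (2 * p)} {Z : ℕ → Set S.left} (hZc : ∀ k, IsClosed (Z k))
    (hL : {t : ComplexPoints S | complexBetti.map (fiberι f t) (2 * p) A ∈ algebraicClasses (fiberOver f t) p} =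
      ⋃ k, {t : ComplexPoints S | t.pt ∈ Z k})
    {U : Set (ComplexPoints S)} (hU : IsOpen U) (hUne : U.Nonempty)
    (hUalg : ∀ t ∈ U, complexBetti.map (fiberι f t) (2 * p) A ∈ algebraicClasses (fiberOver f t) p) :
    (∃ k, Z k = Set.univ) ∧
      ∀ t : ComplexPoints S, complexBetti.map (fiberι f t) (2 * p) A ∈ algebraicClasses (fiberOver f t) p := by
  have hUW : U ⊆ ⋃ k, {t : ComplexPoints S | t.pt ∈ Z k} := by
    rw [← hL]
    exact fun t ht ↦ hUalg t ht
  obtain ⟨k, hk⟩ := exists_stratum_eq_univ_of_isOpen_subset_iUnion hS hZc hU hUne hUW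
  exact ⟨⟨k, hk⟩, forall_mem_algebraicClasses_of_stratum_eq_univ f hL hk⟩

/-- **THE SPREADING STEP, fact-free on the tree's carriers** (rev. 2): for a smooth projective family with
quasi-projective total space over a smooth irreducible quasi-projective base and ANY global class `A ∈ H²ᵖ(𝒳(ℂ); ℂ)`,
if `A|_{𝒳_t}` is algebraic for all `t` in a non-empty Euclidean-open `U ⊆ S(ℂ)` then it is algebraic at EVERY
`t ∈ S(ℂ)` — the Charles–Schnell decomposition of the algebraicity locus is PROVED in the tree
(`charlesSchnell_algebraicityLocus_iUnion_closed_holds`) and `forall_mem_algebraicClasses_of_isOpen_of_strata` applies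
(Voisin II §7.3.2: "if `f ∈ B` is general and `f ∈ pᵢ(Hᵢ)`, then `pᵢ(Hᵢ) = B`"). No named fact, no cell hypothesis.
[cite: VoisinHodgeII2003, §7.3.2, proof of Thm. 7.19] [cite: CharlesSchnell2014Notes, Prop. 11.3.11 (proof)] -/
theorem forall_mem_algebraicClasses_of_isOpen (f : 𝒳 ⟶ S) {n p : ℕ} (h𝒳 : IsQuasiProjectiveOver 𝒳)
    (hS : IsQuasiProjectiveOver S) (hSsm : AlgebraicGeometry.Smooth S.hom) [IrreducibleSpace S.left]
    (hf : IsSmoothProjectiveFamily f n) (A : complexBetti 𝒳 (2 * p)) {U : Set (ComplexPoints S)} (hU : IsOpen U)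
    (hUne : U.Nonempty)
    (hUalg : ∀ t ∈ U, complexBetti.map (fiberι f t) (2 * p) A ∈ algebraicClasses (fiberOver f t) p)
    (t : ComplexPoints S) : complexBetti.map (fiberι f t) (2 * p) A ∈ algebraicClasses (fiberOver f t) p := by
  obtain ⟨Z, hZc, hL⟩ := charlesSchnell_algebraicityLocus_iUnion_closed_holds f n p h𝒳 hS hSsm hf A
  exact (forall_mem_algebraicClasses_of_isOpen_of_strata f hS hZc hL hU hUne hUalg).2 t

/-- **Row U on a family ⟺ its GERM form at one CM fibre**: on a row-U family (smooth projective over a smooth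
irreducible quasi-projective base, quasi-projective total space, dense CM locus), `UniformAlgebraicityOn f n` holds
iff every admissible `W` algebraic at all CM fibres is algebraic on some Euclidean-open neighbourhood of SOME CM fibre —
exactly the conclusion shape of `HodgeTheory.BlochSemiregularSpread` at a CM anchor. (⟹: density of the CM locus makes
row U's closed stratum everything; ⟸: the fact-free spreading step `forall_mem_algebraicClasses_of_isOpen` — PROVED
Hilbert-scheme decomposition `charlesSchnell_algebraicityLocus_iUnion_closed_holds` + Baire.)
[cite: BuchweitzFlenner2003, Thm. 5.2 (conclusion shape)]
[cite: VoisinHodgeII2003, §7.3.2] [cite: CharlesSchnell2014Notes, Prop. 11.3.11] -/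
theorem uniformAlgebraicityOn_iff_germ_at_cmLocus (f : 𝒳 ⟶ S) {n : ℕ} (h𝒳 : IsQuasiProjectiveOver 𝒳)
    (hS : IsQuasiProjectiveOver S) (hSsm : AlgebraicGeometry.Smooth S.hom) [IrreducibleSpace S.left]
    [Nonempty (ComplexPoints S)] (hf : IsSmoothProjectiveFamily f n) (hD : Dense (cmLocus f n)) :
    UniformAlgebraicityOn f n ↔
      ∀ (p : ℕ) (W : complexBetti 𝒳 (2 * p)),
        (∀ s : ComplexPoints S, IsRationalClass (complexBetti.map (fiberι f s) (2 * p) W) ∧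
          IsOfHodgeType n (fiberOver f s) (2 * p) p p (complexBetti.map (fiberι f s) (2 * p) W)) →
        (∀ s ∈ cmLocus f n, complexBetti.map (fiberι f s) (2 * p) W ∈ algebraicClasses (fiberOver f s) p) →
        ∃ s₀ ∈ cmLocus f n, ∃ U : Set (ComplexPoints S), IsOpen U ∧ s₀ ∈ U ∧
          ∀ t ∈ U, complexBetti.map (fiberι f t) (2 * p) W ∈ algebraicClasses (fiberOver f t) p := by
  constructor
  · intro hU p W hW hcm
    obtain ⟨W₀, hW₀c, hW₀alg, hcmW₀⟩ := hU p W hW hcm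
    obtain ⟨s₀, hs₀⟩ := hD.nonempty
    exact ⟨s₀, hs₀, Set.univ, isOpen_univ, Set.mem_univ _, fun t _ ↦
      forall_mem_algebraicClasses_of_dense_of_subset_closed f hD hW₀c hW₀alg hcmW₀ t⟩
  · intro h p W hW hcm
    obtain ⟨s₀, _, U, hUo, hs₀U, hUalg⟩ := h p W hW hcm
    exact Deform.exists_closed_stratum_of_forall f
      (forall_mem_algebraicClasses_of_isOpen f h𝒳 hS hSsm hf W hUo ⟨s₀, hs₀U⟩ hUalg) _

/-- **Row U (universal) ⟺ its GERM form**: deform's `UniformAlgebraicityAtCMPoints` holds iff on every admissible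
CM-dense family with a complex point, every admissible `W` algebraic at all CM fibres is algebraic on a Euclidean germ
at SOME CM fibre. Fact-free (the Hilbert-scheme decomposition is PROVED in the tree). So the universal input the
Mumford–Tate branch needs from a generization engine is only GERMINAL, at one CM anchor per `(f, W)`.
[cite: BuchweitzFlenner2003, Thm. 5.2 (conclusion shape)] [cite: CharlesSchnell2014Notes, Prop. 11.3.11 and Thm. 11.5.11] -/
theorem uniformAlgebraicityAtCMPoints_iff_forall_germ_at_cmLocus :
    UniformAlgebraicityAtCMPoints ↔
      ∀ ⦃n : ℕ⦄ ⦃𝒳 S : SchemeOver ℂ⦄ (f : 𝒳 ⟶ S), IsSmoothProjectiveFamily f n →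
        IsQuasiProjectiveOver 𝒳 → IsQuasiProjectiveOver S → IrreducibleSpace S.left →
        AlgebraicGeometry.Smooth S.hom →
        (∀ s : ComplexPoints S, ∃ A' : AbelianVariety ℂ, A'.dim = n ∧ Nonempty (A'.X ≅ fiberOver f s)) →
        Dense (cmLocus f n) → Nonempty (ComplexPoints S) →
        ∀ (p : ℕ) (W : complexBetti 𝒳 (2 * p)),
          (∀ s : ComplexPoints S, IsRationalClass (complexBetti.map (fiberι f s) (2 * p) W) ∧
            IsOfHodgeType n (fiberOver f s) (2 * p) p p (complexBetti.map (fiberι f s) (2 * p) W)) →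
          (∀ s ∈ cmLocus f n, complexBetti.map (fiberι f s) (2 * p) W ∈ algebraicClasses (fiberOver f s) p) →
          ∃ s₀ ∈ cmLocus f n, ∃ U : Set (ComplexPoints S), IsOpen U ∧ s₀ ∈ U ∧
            ∀ t ∈ U, complexBetti.map (fiberι f t) (2 * p) W ∈ algebraicClasses (fiberOver f t) p := by
  rw [uniformAlgebraicityAtCMPoints_iff_forall_uniformAlgebraicityOn]
  constructor
  · intro hU n 𝒳 S f hf h𝒳 hS hirr hsm hab hD hne
    haveI := hirr
    haveI := hne
    exact (uniformAlgebraicityOn_iff_germ_at_cmLocus f h𝒳 hS hsm hf hD).1 (hU f hf h𝒳 hS hirr hsm hab hD)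
  · intro h n 𝒳 S f hf h𝒳 hS hirr hsm hab hD
    haveI := hirr
    rcases isEmpty_or_nonempty (ComplexPoints S) with hS₀ | hne
    · exact fun p W _ _ ↦ ⟨Set.univ, isClosed_univ, fun t ↦ (IsEmpty.false t).elim, fun s ↦ (IsEmpty.false s).elim⟩
    · exact (uniformAlgebraicityOn_iff_germ_at_cmLocus f h𝒳 hS hsm hf hD).2 (h f hf h𝒳 hS hirr hsm hab hD hne)

/-- Hence, granted Deligne's family fact, the germ form of row U is a typed conditional toward the item:
`U_germ ⟹[hF] CMToAbelian` (through row U and part III's `closesWithCM_spreadAxis`). [cite: CharlesSchnell2014Notes, Thm. 11.5.11] -/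
theorem cmToAbelian_of_deligne1982_of_forall_germ_at_cmLocus (hF : deligne1982_cmDenseMumfordTateFamilies)
    (h : ∀ ⦃n : ℕ⦄ ⦃𝒳 S : SchemeOver ℂ⦄ (f : 𝒳 ⟶ S), IsSmoothProjectiveFamily f n →
        IsQuasiProjectiveOver 𝒳 → IsQuasiProjectiveOver S → IrreducibleSpace S.left →
        AlgebraicGeometry.Smooth S.hom →
        (∀ s : ComplexPoints S, ∃ A' : AbelianVariety ℂ, A'.dim = n ∧ Nonempty (A'.X ≅ fiberOver f s)) →
        Dense (cmLocus f n) → Nonempty (ComplexPoints S) →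
        ∀ (p : ℕ) (W : complexBetti 𝒳 (2 * p)),
          (∀ s : ComplexPoints S, IsRationalClass (complexBetti.map (fiberι f s) (2 * p) W) ∧
            IsOfHodgeType n (fiberOver f s) (2 * p) p p (complexBetti.map (fiberι f s) (2 * p) W)) →
          (∀ s ∈ cmLocus f n, complexBetti.map (fiberι f s) (2 * p) W ∈ algebraicClasses (fiberOver f s) p) →
          ∃ s₀ ∈ cmLocus f n, ∃ U : Set (ComplexPoints S), IsOpen U ∧ s₀ ∈ U ∧
            ∀ t ∈ U, complexBetti.map (fiberι f t) (2 * p) W ∈ algebraicClasses (fiberOver f t) p) :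
    CMToAbelian :=
  cmToAbelian_of_closesWithCM (closesWithCM_spreadAxis hF).2.2
    (uniformAlgebraicityAtCMPoints_iff_forall_germ_at_cmLocus.2 h)

#print axioms Summit.HodgeConjecture.HodgeConjecture.Ring2.AbelianAll.exists_stratum_eq_univ_of_isOpen_subset_iUnion
#print axioms Summit.HodgeConjecture.HodgeConjecture.Ring2.AbelianAll.forall_mem_algebraicClasses_of_isOpen
#print axioms Summit.HodgeConjecture.HodgeConjecture.Ring2.AbelianAll.finite_strata_cover_cmLocus_iff_forall
#print axioms Summit.HodgeConjecture.HodgeConjecture.Ring2.AbelianAll.uniformAlgebraicityOn_iff_finite_strata_cover_cmLocus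
#print axioms Summit.HodgeConjecture.HodgeConjecture.Ring2.AbelianAll.uniformAlgebraicityOn_iff_germ_at_cmLocus
#print axioms Summit.HodgeConjecture.HodgeConjecture.Ring2.AbelianAll.uniformAlgebraicityAtCMPoints_iff_forall_germ_at_cmLocus

end Summit.HodgeConjecture.HodgeConjecture.Ring2.AbelianAll

end
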